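import Summits.CriticalPhenomena.PercolationContinuityZ3.Theorems.PercNearOneGluingNoHeavyLowerTailSahiCombReadOnce
import Summits.CriticalPhenomena.PercolationContinuityZ3.Theorems.PercNearOneGluingNoHeavyLowerTailSahiC4CombBridge

/-!
# The comb (tensor-Bernstein) hierarchy for Sahi's `E_k`, XIV: read-once images of the small-cube kernel theorems — (M⁺-4) on the monotone algebra
# generated by three independent events

Support file of the one-cut programme (crux `NoHeavyLowerTail`, stmt-CriticalPhenomena-4575; cell `prim-masterthm`, seat P3, gen 3;
`run/shared/lean/prim/prim-masterthm/prim-masterthm-p3/HIERARCHY.md` §10).  Companion of `…SahiCombReadOnce` (`CombPos.readOnce`, `sahiE_readOnce_eq`): the tree's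
kernel theorems on small cubes, transported along read-once substitution of independent gadgets `G e` (`e : Fin m`, determined by the disjoint fibres of `π : ι → Fin m`) into
increasing events of `{0,1}^m`.  For a cube `ι` this covers every family of events of the form `U∘G = {ω | {e | ω ∈ G e} ∈ U}` — the monotone algebra generated by the gadgets.
* `combPos_sahiE_four_readOnce_le_three` — **(M⁺-4) for every quadruple of events in the monotone algebra generated by at most THREE independent events** (any cube, any
  product measure; base: prim-masterthm-p3's kernel cell `SahiC4Cube.sahiE4CombPositivityUpTo_three` through l12-p3's bridge `SahiC4CombBridge.combPos_of_e4Coef_nonneg`);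
(The law-level companion — Sahi's `E_n ≥ 0` for every `n` on the monotone algebra generated by FOUR independent events, from l12-p5's `native_decide` certificates on
four coins — is in the computational file `…SahiCombCoreFour`.)
The gadgets need not be monotone (only their independence enters).  HONEST FRAMING: nothing here asserts (M⁺-k) or `C_k` for `k ≥ 3` in general. [this work]
-/

noncomputable section

namespace Summit.CriticalPhenomena.PercolationContinuityZ3.Theorems

open Finset Function MeasureTheory
open Literature.Combinatorics.Sahi2008
open Literature.Probability.LatticeModels (prodBernoulli)
open Literature.Probability.Percolation (DeterminedBy determinedBy_iff)
open Literature.Probability.Percolation.DecisionTree (ind ind_of_mem ind_of_not_mem ind_nonneg)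
open Literature.Probability.Percolation.BHK2006 (weight)
open SahiComb SahiCombReadOnce

namespace SahiCombReadOnce

variable {ι : Type} [Fintype ι]

/-- **(M⁺-4) on the monotone algebra generated by at most three independent events.**  For `m ≤ 3`, gadgets `G e` (`e : Fin m`) determined by the fibres of `π : ι → Fin m`,
and increasing `U_0,…,U_3 ⊆ 2^{Fin m}`: `q ↦ E_4(μ_q; 1_{U_0∘G},…,1_{U_3∘G})` is comb-positive at multidegree `4` on `[0,1]^ι`. [this work] -/
theorem combPos_sahiE_four_readOnce_le_three {m : ℕ} (hm : m ≤ 3) (π : ι → Fin m) (G : Fin m → Set (Set ι))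
    (hG : ∀ e, DeterminedBy (G e) {i | π i = e}) (U : Fin 4 → Set (Set (Fin m))) (hU : ∀ j, IsUpperSet (U j)) :
    CombPos (fun _ : ι => 4) (fun q => sahiE (bernoulliWeight q) 4 (fun j => ind {ω : Set ι | {e | ω ∈ G e} ∈ U j})) := by
  have h0 : CombPos (fun _ : Fin m => 4) (fun p => sahiE (bernoulliWeight p) 4 (fun j => ind (U j))) := by
    have h := SahiC4CombBridge.combPos_of_e4Coef_nonneg
      (SahiC4Cube.sahiE4CombPositivityUpTo_three m hm (U 0) (U 1) (U 2) (U 3) (hU 0) (hU 1) (hU 2) (hU 3))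
    refine h.congr fun p => ?_
    congr 1; funext j; fin_cases j <;> rfl
  exact CombPos.readOnce π G hG h0

/-- Law-level shadow: Sahi's `E_4(μ_q) ≥ 0` on the monotone algebra generated by at most three independent events. [this work] -/
theorem sahiE_four_readOnce_nonneg_le_three (q : ι → unitInterval) {m : ℕ} (hm : m ≤ 3) (π : ι → Fin m) (G : Fin m → Set (Set ι))
    (hG : ∀ e, DeterminedBy (G e) {i | π i = e}) (U : Fin 4 → Set (Set (Fin m))) (hU : ∀ j, IsUpperSet (U j)) :
    0 ≤ sahiE (bernoulliWeight q) 4 (fun j => ind {ω : Set ι | {e | ω ∈ G e} ∈ U j}) :=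
  (combPos_sahiE_four_readOnce_le_three hm π G hG U hU).nonneg q

end SahiCombReadOnce

end Summit.CriticalPhenomena.PercolationContinuityZ3.Theorems

end
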